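import Summits.ValiantsHypothesis.ValiantsHypothesis.Theorems.MatrixDescartes.Negative.HexadecadeSector

/-!
PLACEMENT NOTE. NEGATIVE knowledge in the Literature (τ) currency, homed under `Theorems/MatrixDescartes/Negative/`:
the filer is a planner seat (val-idea-13 g1) banking its kernel workfile `Cruxes/MatrixDescartes/Lines/hexadecade.lean`
(§ sector, § W-TOWER; texts verbatim, two files at the natural seam per director ruling g12-R159 (e)) after critic
val-idea-crit-4's by-name PASS (VERDICT #7); the crux `MatrixDescartes` (`stmt-ValiantsHypothesis-18050`) is NOT
touched; a prover may re-home these files verbatim to flat `LacunarySymmetroidMatrixDescartesHexadecade*.lean` names.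
VP ≠ VNP is not moved; no summit statement is proved here.

# The hexadecadal sector lies INSIDE the `TauRealZeros` barrier (file 2 of 2): the W-tower

Extends `Literature.…TauRealZeros` / `not_separatedRealZeroTauBound` from metric to geometric (ratio-16) separation;
witness family W_k = Joukowski-conjugated doubling tower (val-idea-crit-4 certificate 2026-08-28, typed and
kernel-checked by val-idea-13 g1); folklore mechanism (Chebyshev/Dickson doubling), new only in the separation
bookkeeping.

`namespace WTower`: `H_0 = Y − 4Z`, `H_{j+1} = H_j(Y² + λ_j² Z², λ_j Y Z)`, `λ_j = 16^{2^j} = 2^{2^{j+2}}`, `W_k = H_k(X, 1)`: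
* `tau_wPoly_le : τ(W_k) ≤ k² + 12k + 5` (one substitution per level, the tree's `constantFreeComplexity_aeval_le`);
* `wPoly_monic` : monic of `natDegree 2^k`; `eval_map_wPoly_grid` : `W_k(16^i) = A − 4B` along the integer pair
  descent `natPair`; `WTowerSigns k` (strict grid alternation), `wTowerSigns_eight` (exact 257-point certificate,
  `decide +kernel`), `isHexadecadal_wPoly`, `card_roots_wPoly`;
* **`not_hexRealZeroTauBound_one : ¬ HexRealZeroTauBound 1`** (`W_8`: 256 real roots > τ + 2 ≤ 167), `_zero`;
* `exists_level`, `not_hexRealZeroTauBound_of_wTowerSigns : (∀ k ≥ 1, WTowerSigns k) → ∀ c, ¬ HexRealZeroTauBound c`.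
  The all-`k` grid-sign theorem `wTowerSigns_all` (hence `∀ c, ¬ HexRealZeroTauBound c`) is kernel-checked sorry-free
  in the crux workfile (v10, § Joukowski itinerary; accepted as the PB3 appendix) and is not part of this cut.

[folklore] Chebyshev/Dickson doubling conjugated by the Joukowski map `w ↦ w + 1/w`, re-dilated per level.
-/

set_option linter.dupNamespace false
set_option maxHeartbeats 800000

noncomputable section

namespace Summit.ValiantsHypothesis.ValiantsHypothesis.Theorems.LacunarySymmetroidMatrixDescartes.Hexadecade

open scoped BigOperators Polynomial
open Polynomial
open Literature.Computability.AlgebraicComplexity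

namespace WTower

/-- Level-`j+1` substitution of the tower: `(Y, Z) ↦ (Y² + λ_j² Z², λ_j Y Z)` with
`λ_j = 16^(2^j) = 2^(2^(j+2))` (so `λ_j² = 2^(2^(j+3))`). -/
noncomputable def sig (j : ℕ) : Fin 2 → MvPolynomial (Fin 2) ℤ :=
  ![MvPolynomial.X 0 ^ 2 + MvPolynomial.C ((2:ℤ) ^ 2 ^ (j + 3)) * MvPolynomial.X 1 ^ 2,
    MvPolynomial.C ((2:ℤ) ^ 2 ^ (j + 2)) * MvPolynomial.X 0 * MvPolynomial.X 1]

/-- The homogeneous tower `H_0 = Y − 4Z`, `H_{j+1} = H_j ∘ σ_j` (composition = ONE use of the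
circuit for `H_j`: this is where the `τ = O(k²)` (with sharing `O(k)`) comes from). -/
noncomputable def wH : ℕ → MvPolynomial (Fin 2) ℤ
  | 0 => MvPolynomial.X 0 - MvPolynomial.C ((2:ℤ) ^ 2 ^ 1) * MvPolynomial.X 1
  | j + 1 => MvPolynomial.aeval (sig j) (wH j)

/-- `τ(σ_j,0) ≤ j + 8`. -/
theorem tau_sig_zero (j : ℕ) : constantFreeComplexity (sig j 0) ≤ j + 8 := by
  simp only [sig, Matrix.cons_val_zero]
  calc constantFreeComplexity (MvPolynomial.X 0 ^ 2
          + MvPolynomial.C ((2:ℤ) ^ 2 ^ (j + 3)) * MvPolynomial.X 1 ^ 2 : MvPolynomial (Fin 2) ℤ)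
      ≤ constantFreeComplexity (MvPolynomial.X (0 : Fin 2) ^ 2 : MvPolynomial (Fin 2) ℤ)
        + constantFreeComplexity (MvPolynomial.C ((2:ℤ) ^ 2 ^ (j + 3)) * MvPolynomial.X 1 ^ 2 :
            MvPolynomial (Fin 2) ℤ) + 1 := constantFreeComplexity_add_le _ _
    _ ≤ (0 + 1) + ((j + 3 + 1) + (0 + 1) + 1) + 1 := by
        gcongr
        · exact (constantFreeComplexity_sq_le _).trans (by simp)
        · exact (constantFreeComplexity_mul_le _ _).trans (by
            gcongr
            · exact constantFreeComplexity_C_two_pow_two_pow_le _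
            · exact (constantFreeComplexity_sq_le _).trans (by simp))
    _ = j + 8 := by ring

/-- `τ(σ_j,1) ≤ j + 5`. -/
theorem tau_sig_one (j : ℕ) : constantFreeComplexity (sig j 1) ≤ j + 5 := by
  simp only [sig, Matrix.cons_val_one]
  calc constantFreeComplexity (MvPolynomial.C ((2:ℤ) ^ 2 ^ (j + 2)) * MvPolynomial.X 0 * MvPolynomial.X 1 :
          MvPolynomial (Fin 2) ℤ)
      ≤ constantFreeComplexity (MvPolynomial.C ((2:ℤ) ^ 2 ^ (j + 2)) * MvPolynomial.X 0 :
            MvPolynomial (Fin 2) ℤ)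
        + constantFreeComplexity (MvPolynomial.X (1 : Fin 2) : MvPolynomial (Fin 2) ℤ) + 1 :=
          constantFreeComplexity_mul_le _ _
    _ ≤ ((j + 2 + 1) + 0 + 1) + 0 + 1 := by
        gcongr
        · exact (constantFreeComplexity_mul_le _ _).trans (by
            gcongr
            · exact constantFreeComplexity_C_two_pow_two_pow_le _
            · simp)
        · simp
    _ = j + 5 := by ring

/-- **`τ(H_k) ≤ k² + 12k + 5`** (sharing-free bookkeeping with the tree's substitution bound). -/
theorem tau_wH_le (k : ℕ) : constantFreeComplexity (wH k) ≤ k ^ 2 + 12 * k + 5 := by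
  induction k with
  | zero =>
    simp only [wH]
    calc constantFreeComplexity (MvPolynomial.X 0 - MvPolynomial.C ((2:ℤ) ^ 2 ^ 1) * MvPolynomial.X 1 :
            MvPolynomial (Fin 2) ℤ)
        ≤ constantFreeComplexity (MvPolynomial.X (0 : Fin 2) : MvPolynomial (Fin 2) ℤ)
          + constantFreeComplexity (MvPolynomial.C ((2:ℤ) ^ 2 ^ 1) * MvPolynomial.X 1 :
              MvPolynomial (Fin 2) ℤ) + 2 := constantFreeComplexity_sub_le _ _
      _ ≤ 0 + ((1 + 1) + 0 + 1) + 2 := by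
          gcongr
          · simp
          · exact (constantFreeComplexity_mul_le _ _).trans (by
              gcongr
              · exact constantFreeComplexity_C_two_pow_two_pow_le _
              · simp)
      _ = _ := by norm_num
  | succ k ih =>
    simp only [wH]
    calc constantFreeComplexity (MvPolynomial.aeval (sig k) (wH k))
        ≤ constantFreeComplexity (wH k) + ∑ i, constantFreeComplexity (sig k i) :=
          constantFreeComplexity_aeval_le _ _
      _ ≤ (k ^ 2 + 12 * k + 5) + ((k + 8) + (k + 5)) := by
          rw [Fin.sum_univ_two]
          gcongr
          · exact tau_sig_zero k
          · exact tau_sig_one k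
      _ = (k + 1) ^ 2 + 12 * (k + 1) + 5 := by ring

/-- The descent evaluator: `desc j Y Z = H_j(Y, Z)` computed top-down on pairs. -/
def desc {R : Type*} [CommRing R] : ℕ → R → R → R
  | 0, Y, Z => Y - (2:R) ^ 2 ^ 1 * Z
  | j + 1, Y, Z => desc j (Y ^ 2 + (2:R) ^ 2 ^ (j + 3) * Z ^ 2) ((2:R) ^ 2 ^ (j + 2) * Y * Z)

/-- Evaluating `H_j` at a pair is the descent `desc j`. -/
theorem aeval_wH {R : Type*} [CommRing R] (j : ℕ) (Y Z : R) :
    MvPolynomial.aeval ![Y, Z] (wH j) = desc j Y Z := by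
  induction j generalizing Y Z with
  | zero => simp [wH, desc]; norm_num
  | succ j ih =>
    simp only [wH, desc]
    rw [MvPolynomial.comp_aeval_apply]
    have : (fun i => MvPolynomial.aeval ![Y, Z] (sig j i)) =
        ![Y ^ 2 + (2:R) ^ 2 ^ (j + 3) * Z ^ 2, (2:R) ^ 2 ^ (j + 2) * Y * Z] := by
      funext i; fin_cases i <;> simp [sig, map_pow]
    rw [this, ih]

/-- **The W-tower** `W_k := H_k(X, 1) ∈ ℤ[X]`. -/
noncomputable def wPoly (k : ℕ) : ℤ[X] := MvPolynomial.aeval ![(X : ℤ[X]), 1] (wH k)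

/-- `W_k` as the descent applied to `(X, 1)`. -/
theorem wPoly_eq_desc (k : ℕ) : wPoly k = desc k (X : ℤ[X]) 1 := aeval_wH k X 1

/-- Multiplying by the constant `2^n` does not raise the degree. -/
private theorem natDegree_two_pow_mul_le (n : ℕ) (p : ℤ[X]) :
    ((2:ℤ[X]) ^ n * p).natDegree ≤ p.natDegree := by
  have : ((2:ℤ[X]) ^ n) = C ((2:ℤ) ^ n) := by simp
  rw [this]; exact natDegree_C_mul_le _ _

/-- The descent preserves «monic in `Y`, `deg Z < deg Y`» and doubles the degree per level. -/
theorem desc_monic (j : ℕ) : ∀ (D : ℕ) (Y Z : ℤ[X]), Y.Monic → Y.natDegree = D →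
    Z.natDegree + 1 ≤ D → (desc j Y Z).Monic ∧ (desc j Y Z).natDegree = D * 2 ^ j := by
  induction j with
  | zero =>
    intro D Y Z hY hD hZ
    simp only [desc]
    have hlt : ((2:ℤ[X]) ^ 2 ^ 1 * Z).degree < Y.degree := by
      apply degree_lt_degree
      calc ((2:ℤ[X]) ^ 2 ^ 1 * Z).natDegree ≤ Z.natDegree := natDegree_two_pow_mul_le _ _
        _ < Y.natDegree := by omega
    have hlt' : ((2:ℤ[X]) ^ 2 ^ 1 * Z).natDegree < Y.natDegree := by
      calc ((2:ℤ[X]) ^ 2 ^ 1 * Z).natDegree ≤ Z.natDegree := natDegree_two_pow_mul_le _ _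
        _ < Y.natDegree := by omega
    exact ⟨hY.sub_of_left hlt, by rw [natDegree_sub_eq_left_of_natDegree_lt hlt', hD]; ring⟩
  | succ j ih =>
    intro D Y Z hY hD hZ
    simp only [desc]
    have hY2 : (Y ^ 2).Monic := hY.pow 2
    have hY2d : (Y ^ 2).natDegree = 2 * D := by rw [hY.natDegree_pow, hD]
    have hlt : ((2:ℤ[X]) ^ 2 ^ (j + 3) * Z ^ 2).degree < (Y ^ 2).degree := by
      apply degree_lt_degree
      calc ((2:ℤ[X]) ^ 2 ^ (j + 3) * Z ^ 2).natDegree ≤ (Z ^ 2).natDegree := natDegree_two_pow_mul_le _ _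
        _ ≤ 2 * Z.natDegree := natDegree_pow_le
        _ < (Y ^ 2).natDegree := by rw [hY2d]; omega
    have hY' : (Y ^ 2 + (2:ℤ[X]) ^ 2 ^ (j + 3) * Z ^ 2).Monic := hY2.add_of_left hlt
    have hY'd : (Y ^ 2 + (2:ℤ[X]) ^ 2 ^ (j + 3) * Z ^ 2).natDegree = 2 * D := by
      rw [natDegree_add_eq_left_of_degree_lt hlt, hY2d]
    have hZ' : ((2:ℤ[X]) ^ 2 ^ (j + 2) * Y * Z).natDegree + 1 ≤ 2 * D := by
      calc ((2:ℤ[X]) ^ 2 ^ (j + 2) * Y * Z).natDegree + 1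
          ≤ (((2:ℤ[X]) ^ 2 ^ (j + 2) * Y).natDegree + Z.natDegree) + 1 := by
            gcongr; exact natDegree_mul_le
        _ ≤ (Y.natDegree + Z.natDegree) + 1 := by gcongr; exact natDegree_two_pow_mul_le _ _
        _ ≤ 2 * D := by omega
    obtain ⟨hm, hd⟩ := ih (2 * D) _ _ hY' hY'd hZ'
    exact ⟨hm, by rw [hd]; ring⟩

/-- `W_k` is monic of degree `2^k` (hence nonzero). -/
theorem wPoly_monic (k : ℕ) : (wPoly k).Monic ∧ (wPoly k).natDegree = 2 ^ k := by
  rw [wPoly_eq_desc]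
  have h := desc_monic k 1 (X : ℤ[X]) 1 monic_X natDegree_X (by simp)
  simpa using h

/-- Evaluation of `W_k` over `ℝ` is the descent. -/
theorem eval_map_wPoly (k : ℕ) (x : ℝ) :
    ((wPoly k).map (Int.castRingHom ℝ)).eval x = desc k x 1 := by
  rw [Polynomial.eval_map, ← algebraMap_int_eq, ← Polynomial.aeval_def, wPoly,
    MvPolynomial.comp_aeval_apply]
  have : (fun i => Polynomial.aeval x ((![(X : ℤ[X]), 1] : Fin 2 → ℤ[X]) i)) = ![x, 1] := by
    funext i; fin_cases i <;> simp
  rw [this, aeval_wH]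

/-- The integer pair descent used for the exact sign certificate. -/
def natPair : ℕ → ℕ × ℕ → ℕ × ℕ
  | 0, p => p
  | j + 1, p => natPair j (p.1 ^ 2 + 2 ^ 2 ^ (j + 3) * p.2 ^ 2, 2 ^ 2 ^ (j + 2) * p.1 * p.2)

/-- On natural-number inputs the real descent is the integer pair descent `natPair`. -/
theorem desc_natCast (j : ℕ) : ∀ (Y Z : ℕ),
    desc j (Y : ℝ) (Z : ℝ) = ((natPair j (Y, Z)).1 : ℝ) - 4 * ((natPair j (Y, Z)).2 : ℝ) := by
  induction j with
  | zero => intro Y Z; simp only [desc, natPair]; norm_num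
  | succ j ih =>
    intro Y Z
    simp only [desc, natPair]
    rw [show ((Y:ℝ) ^ 2 + (2:ℝ) ^ 2 ^ (j + 3) * (Z:ℝ) ^ 2) = ((Y ^ 2 + 2 ^ 2 ^ (j + 3) * Z ^ 2 : ℕ) : ℝ) by
          push_cast; ring,
        show ((2:ℝ) ^ 2 ^ (j + 2) * (Y:ℝ) * (Z:ℝ)) = ((2 ^ 2 ^ (j + 2) * Y * Z : ℕ) : ℝ) by
          push_cast; ring, ih]

/-- `W_k(16^i) > 0` for even `i`, `< 0` for odd `i` (`i ≤ 2^k`): the grid-sign statement, as a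
property of the integer descent. -/
def WTowerSigns (k : ℕ) : Prop :=
  ∀ i : ℕ, i < 2 ^ k + 1 →
    (i % 2 = 0 → 4 * (natPair k (16 ^ i, 1)).2 < (natPair k (16 ^ i, 1)).1) ∧
    (i % 2 = 1 → (natPair k (16 ^ i, 1)).1 < 4 * (natPair k (16 ^ i, 1)).2)

/-- Boolean certificate checker (run by the kernel with GMP arithmetic). -/
def signOK (k i : ℕ) : Bool :=
  if i % 2 = 0 then decide (4 * (natPair k (16 ^ i, 1)).2 < (natPair k (16 ^ i, 1)).1)
  else decide ((natPair k (16 ^ i, 1)).1 < 4 * (natPair k (16 ^ i, 1)).2)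

/-- All `2^k + 1` grid signs at level `k`. -/
def certOK (k : ℕ) : Bool := (List.range (2 ^ k + 1)).all (signOK k)

/-- Soundness of the certificate checker. -/
theorem wTowerSigns_of_certOK {k : ℕ} (h : certOK k = true) : WTowerSigns k := by
  intro i hi
  have hs : signOK k i = true := by
    unfold certOK at h; rw [List.all_eq_true] at h; exact h i (List.mem_range.mpr hi)
  unfold signOK at hs
  split_ifs at hs with hpar
  · exact ⟨fun _ => of_decide_eq_true hs, fun h1 => by omega⟩
  · exact ⟨fun h0 => absurd h0 hpar, fun _ => of_decide_eq_true hs⟩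

/-- **Exact kernel certificate, `k = 8`**: `W_8` alternates strictly in sign on `16^0, …, 16^256`
(257 evaluations of an 8-level integer recursion on ≤ 2^18-bit numbers). -/
theorem wTowerSigns_eight : WTowerSigns 8 := wTowerSigns_of_certOK (by decide +kernel)

/-- `W_k(16^i)` in terms of the integer pair descent. -/
theorem eval_map_wPoly_grid (k i : ℕ) :
    ((wPoly k).map (Int.castRingHom ℝ)).eval ((16:ℝ) ^ i) =
      ((natPair k (16 ^ i, 1)).1 : ℝ) - 4 * ((natPair k (16 ^ i, 1)).2 : ℝ) := by
  rw [eval_map_wPoly, show ((16:ℝ) ^ i) = ((16 ^ i : ℕ) : ℝ) by push_cast; ring,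
    show (1:ℝ) = ((1:ℕ) : ℝ) by simp, desc_natCast]

/-- Grid signs ⇒ `W_k` is hexadecadal (base point `x₀ = 1`). -/
theorem isHexadecadal_wPoly {k : ℕ} (h : WTowerSigns k) :
    IsHexadecadal ((wPoly k).map (Int.castRingHom ℝ)) := by
  obtain ⟨hmon, hdeg⟩ := wPoly_monic k
  have hdeg' : ((wPoly k).map (Int.castRingHom ℝ)).natDegree = 2 ^ k := by
    rw [hmon.natDegree_map, hdeg]
  unfold IsHexadecadal
  rw [hdeg']
  refine ⟨1, one_ne_zero, fun i hi => ?_⟩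
  rw [one_mul, one_mul, eval_map_wPoly_grid, eval_map_wPoly_grid]
  obtain ⟨h0, h1⟩ := h i (by omega)
  obtain ⟨h0', h1'⟩ := h (i + 1) (by omega)
  rcases Nat.mod_two_eq_zero_or_one i with hp | hp
  · have ha := h0 hp
    have hb := h1' (by omega)
    apply mul_neg_of_pos_of_neg
    · have : ((4 * (natPair k (16 ^ i, 1)).2 : ℕ) : ℝ) < ((natPair k (16 ^ i, 1)).1 : ℝ) := by
        exact_mod_cast ha
      push_cast at this; linarith
    · have : (((natPair k (16 ^ (i+1), 1)).1 : ℕ) : ℝ) < ((4 * (natPair k (16 ^ (i+1), 1)).2 : ℕ) : ℝ) := by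
        exact_mod_cast hb
      push_cast at this; linarith
  · have ha := h1 hp
    have hb := h0' (by omega)
    apply mul_neg_of_neg_of_pos
    · have : (((natPair k (16 ^ i, 1)).1 : ℕ) : ℝ) < ((4 * (natPair k (16 ^ i, 1)).2 : ℕ) : ℝ) := by
        exact_mod_cast ha
      push_cast at this; linarith
    · have : ((4 * (natPair k (16 ^ (i+1), 1)).2 : ℕ) : ℝ) < ((natPair k (16 ^ (i+1), 1)).1 : ℝ) := by
        exact_mod_cast hb
      push_cast at this; linarith

/-- `τ` of `W_k` rendered as in the barrier file: `≤ k² + 12k + 5`. -/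
theorem symm_wPoly (k : ℕ) :
    (MvPolynomial.uniqueAlgEquiv ℤ (Fin 1)).symm (wPoly k) =
      MvPolynomial.aeval ![MvPolynomial.X 0, 1] (wH k) := by
  rw [AlgEquiv.symm_apply_eq, wPoly]
  rw [show (MvPolynomial.uniqueAlgEquiv ℤ (Fin 1)) (MvPolynomial.aeval ![MvPolynomial.X 0, 1] (wH k))
      = ((MvPolynomial.uniqueAlgEquiv ℤ (Fin 1) : MvPolynomial (Fin 1) ℤ →ₐ[ℤ] ℤ[X]))
          (MvPolynomial.aeval ![MvPolynomial.X 0, 1] (wH k)) from rfl,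
    MvPolynomial.comp_aeval_apply]
  have : (fun i => (MvPolynomial.uniqueAlgEquiv ℤ (Fin 1) : MvPolynomial (Fin 1) ℤ →ₐ[ℤ] ℤ[X])
      ((![MvPolynomial.X 0, 1] : Fin 2 → MvPolynomial (Fin 1) ℤ) i)) = ![(X : ℤ[X]), 1] := by
    funext i; fin_cases i <;> simp [MvPolynomial.uniqueAlgEquiv_apply]
  rw [this]

/-- **`τ(W_k) ≤ k² + 12k + 5`** in the barrier file's rendering `(uniqueAlgEquiv ℤ (Fin 1)).symm`. -/
theorem tau_wPoly_le (k : ℕ) :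
    constantFreeComplexity ((MvPolynomial.uniqueAlgEquiv ℤ (Fin 1)).symm (wPoly k)) ≤
      k ^ 2 + 12 * k + 5 := by
  rw [symm_wPoly]
  calc constantFreeComplexity (MvPolynomial.aeval ![MvPolynomial.X 0, 1] (wH k))
      ≤ constantFreeComplexity (wH k)
        + ∑ i, constantFreeComplexity ((![MvPolynomial.X 0, 1] : Fin 2 → MvPolynomial (Fin 1) ℤ) i) :=
        constantFreeComplexity_aeval_le _ _
    _ ≤ (k ^ 2 + 12 * k + 5) + 0 := by
        gcongr
        · exact tau_wH_le k
        · simp [Fin.sum_univ_two]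

/-- Grid signs at level `k` ⇒ `W_k` has exactly `2^k` distinct real roots. -/
theorem card_roots_wPoly {k : ℕ} (h : WTowerSigns k) :
    ((wPoly k).map (Int.castRingHom ℝ)).roots.toFinset.card = 2 ^ k := by
  rw [card_roots_eq_natDegree_of_isHexadecadal (isHexadecadal_wPoly h),
    (wPoly_monic k).1.natDegree_map, (wPoly_monic k).2]

/-- **`HexRealZeroTauBound 1` is FALSE** (kernel-checked): `W_8` is hexadecadal with `256`
real roots and `τ(W_8) + 2 ≤ 167`. -/
theorem not_hexRealZeroTauBound_one : ¬ HexRealZeroTauBound 1 := by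
  intro h
  have h1 := h (wPoly 8) (wPoly_monic 8).1.ne_zero (isHexadecadal_wPoly wTowerSigns_eight)
  rw [card_roots_wPoly wTowerSigns_eight, pow_one] at h1
  have h2 := tau_wPoly_le 8
  omega

/-- Hence also `¬ HexRealZeroTauBound 0`. -/
theorem not_hexRealZeroTauBound_zero : ¬ HexRealZeroTauBound 0 := by
  intro h
  have h1 := h (wPoly 8) (wPoly_monic 8).1.ne_zero (isHexadecadal_wPoly wTowerSigns_eight)
  rw [card_roots_wPoly wTowerSigns_eight, pow_zero] at h1
  omega

/-- Polynomial vs exponential: the level at which the tower beats exponent `c`. -/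
theorem exists_level (c : ℕ) : ∃ k : ℕ, 1 ≤ k ∧ (k ^ 2 + 12 * k + 5 + 2) ^ c < 2 ^ k := by
  refine ⟨2 ^ (2 * c + 5), Nat.one_le_two_pow, ?_⟩
  set t := 2 * c + 5 with ht
  have hk : (32:ℕ) ≤ 2 ^ t := by
    calc (32:ℕ) = 2 ^ 5 := by norm_num
      _ ≤ 2 ^ t := Nat.pow_le_pow_right (by norm_num) (by omega)
  have hpoly : (2 ^ t) ^ 2 + 12 * 2 ^ t + 5 + 2 ≤ 2 ^ (2 * t + 1) := by
    have : 2 ^ (2 * t + 1) = 2 * (2 ^ t) ^ 2 := by ring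
    rw [this]; nlinarith
  have hexp : (2 * t + 1) * c < 2 ^ t := by
    have hc : c < 2 ^ c := Nat.lt_two_pow_self
    have h4 : 2 ^ t = 32 * (2 ^ c) ^ 2 := by rw [ht]; ring
    rw [h4]; nlinarith
  calc ((2 ^ t) ^ 2 + 12 * 2 ^ t + 5 + 2) ^ c ≤ (2 ^ (2 * t + 1)) ^ c := Nat.pow_le_pow_left hpoly c
    _ = 2 ^ ((2 * t + 1) * c) := by rw [← pow_mul]
    _ < 2 ^ 2 ^ t := Nat.pow_lt_pow_right (by norm_num) hexp

/-- **All-`k` grid signs (`k ≥ 1`; note `WTowerSigns 0` is false: `W_0 = X − 4 < 0` at `16^0`) ⇒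
`HexRealZeroTauBound c` fails for EVERY `c`.** -/
theorem not_hexRealZeroTauBound_of_wTowerSigns (h : ∀ k, 1 ≤ k → WTowerSigns k) (c : ℕ) :
    ¬ HexRealZeroTauBound c := by
  intro hc
  obtain ⟨k, hk1, hk⟩ := exists_level c
  have h1 := hc (wPoly k) (wPoly_monic k).1.ne_zero (isHexadecadal_wPoly (h k hk1))
  rw [card_roots_wPoly (h k hk1)] at h1
  have h2 : (constantFreeComplexity ((MvPolynomial.uniqueAlgEquiv ℤ (Fin 1)).symm (wPoly k)) + 2) ^ c
      ≤ (k ^ 2 + 12 * k + 5 + 2) ^ c := Nat.pow_le_pow_left (by have := tau_wPoly_le k; omega) c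
  omega

end WTower

end Summit.ValiantsHypothesis.ValiantsHypothesis.Theorems.LacunarySymmetroidMatrixDescartes.Hexadecade
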